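import Summits.QuantumFields.BalabanUV.T4Continuum.Support.NE7FlatGradientLetterBlockDiv
import HarnessLib

/-!
# NE7FlatInteriorCoreDivForm — pv23's CORE BOUND for the cut-off Green representation with the source in DIVERGENCE FORM (file 1∕2 of the flat interior C¹ letter
# `NE7FlatInteriorGradientDivForm`): `|Σ_y Φ(x−y)Δ(χu)(y)| ≤ d·Qs·(E₁S_{p+1} + 4·2^pE₀S_p∕m) + Rs·E₀S_p + B·d·(2E₁2^{p+1}4 + E₀2^p4)∕m^{p+2}`

Cell `pub-balaban`, rung (B)+1 sub-cell t4; row-NE7b owner lineage `b2b-balaban-t4-ne7b-p1` (gen 155), JUNCTION SERVICE for row NE7's supplier stub (S-h) (t4-ne7-p1 g108,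
[NE7P1-G108-INBOX-1] (4)(b); my pricing [NE7bP1-G155-INBOX-4] (2)).  Over pv23's `Beta/PoissonInterior` (`Site d = ℤ^d`, `cube`, `nrm`, the C¹ spline `cutoff m x`,
`sum_shift`, `lap_mul`, `core_bound`).
THE POINT.  pv23's `core_bound` charges the `χΔu` term through `sup|Δu|·E₀·S_p`; when `Δu(y) = Σ_μ (q(y,μ) − q(y−e_μ,μ)) + r(y)` the lattice divergence is moved onto the
weight by one summation by parts (`sum_shift`): `Σ_y Φ(x−y)χ(y)(q(y,μ) − q(y−e_μ,μ)) = Σ_y [Φ(x−y)χ(y) − Φ(x−y−e_μ)χ(y+e_μ)]·q(y,μ)` with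
`|Φ(x−y)χ(y) − Φ(x−y−e_μ)χ(y+e_μ)| ≤ E₁nrm(x−y)^{−(p+1)} + 4·2^pE₀nrm(x−y)^{−p}∕m` (kernel difference `hΦd`, `|χ| ≤ 1`, `|∇χ| ≤ 4∕m`, `nrm(v−e) ≥ nrm v∕2`); the
cutoff brackets are pv23's Steps 2–3 VERBATIM.
WHAT ([folklore]; 0 def, 0 sorry).  **`core_bound_divForm`** (statement in the title; `S_j = Σ_{cube 0 (3m)} nrm^{−j}`; hypotheses: kernel envelopes as in `core_bound`, the
divergence-form identity and the bounds `|q| ≤ Qs`, `|r| ≤ Rs` on `cube x (3m)`, `Σ_{cube}|u| ≤ B`).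
HONEST FRAMING (page 1): flat `ℤ^d` potential theory, [folklore]; nothing of Bałaban's asserted; (10) TYPE NOT proved; NE3∕NE7 NOT proved; row NE7b NOT PRINTED ∕ NOT PROVED;
spine count = dagwriter's call; finite T⁴ rung (B)+1 — NOT infinite volume, NOT mass gap, NOT BetaPertH, NOT Clay.
-/

set_option autoImplicit false

open scoped BigOperators
open Finset Real

namespace Summit.QuantumFields.BalabanUV.T4Continuum.NE7FlatInteriorCoreDivForm

open Literature.MathematicalPhysics.QuantumFieldTheory.Balaban1983to89
open B7Prop1Explicit (Site)
open Literature.Probability.LatticeModels (latticeLaplacianZd)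
open Beta.PoissonInterior (cube mem_cube cube_mono supNorm supNorm_neg supNorm_single_one nrm nrm_pos G₀ dG₀ G₀_diff_bound G₀_diff2_bound
  sum_cube_inv_nrm_pow_le sum_shift cutoff cutoff_eq_zero_of_not_mem abs_cutoff_le_one cutoff_diff_le cutoff_diff2_le cutoff_shift_eq_one
  add_mem_cube_succ sub_mem_cube_succ le_supNorm_of half_le_nrm half_le_nrm_add inv_nrm_pow_le nrm_shift_ge_half sum_cube_reflect lap_mul
  rep_increment)

noncomputable section

variable {d : ℕ}

/-! ## §1 pv23's core bound with the source in divergence form -/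

set_option maxHeartbeats 400000 in
/-- **CORE BOUND, DIVERGENCE-FORM SOURCE.** For a kernel `Φ` with envelopes `|Φ| ≤ E₀ nrm^{-p}`, `|∇^±Φ| ≤ E₁ nrm^{-(p+1)}`, a function `u` with
`Δu(y) = Σ_μ (q(y,μ) − q(y−e_μ,μ)) + r(y)`, `|q| ≤ Qs`, `|r| ≤ Rs` on `cube x (3m)` and `∑_{cube x (3m)} |u| ≤ B`, and pv23's cutoff `χ = cutoff m x`:
`|∑_y Φ(x-y) Δ(χu)(y)| ≤ d·Qs·(E₁·S_{p+1} + 4·2^p·E₀·S_p∕m) + Rs·E₀·S_p + B·d·(2E₁2^{p+1}·4 + E₀2^p·4)∕m^{p+2}`, `S_j = Σ_{cube 0 (3m)} nrm^{−j}` — the `χΔu` term of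
pv23's `core_bound` re-done with the lattice divergence moved onto `Φχ` by `sum_shift`; the cutoff terms verbatim. [folklore] -/
theorem core_bound_divForm {m : ℕ} (hm : 1 ≤ m) (Φ : Site d → ℝ) {p : ℕ} {E₀ E₁ : ℝ}
    (hE₀ : 0 ≤ E₀) (hE₁ : 0 ≤ E₁)
    (hΦ : ∀ v, |Φ v| ≤ E₀ / nrm v ^ p)
    (hΦd : ∀ v (i : Fin d), |Φ (v + Pi.single i 1) - Φ v| ≤ E₁ / nrm v ^ (p + 1) ∧
      |Φ (v - Pi.single i 1) - Φ v| ≤ E₁ / nrm v ^ (p + 1))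
    (u : Site d → ℝ) (q : Site d → Fin d → ℝ) (r : Site d → ℝ) (x : Site d) {Qs Rs B : ℝ}
    (hdiv : ∀ y ∈ cube x (3 * m), latticeLaplacianZd u y = (∑ μ : Fin d, (q y μ - q (y - Pi.single μ 1) μ)) + r y)
    (hq : ∀ y ∈ cube x (3 * m), ∀ μ : Fin d, |q y μ| ≤ Qs) (hr : ∀ y ∈ cube x (3 * m), |r y| ≤ Rs)
    (hB : ∑ y ∈ cube x (3 * m), |u y| ≤ B) :
    |∑ y ∈ cube x (3 * m), Φ (x - y) * latticeLaplacianZd (fun z => cutoff m x z * u z) y| ≤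
      d * Qs * (E₁ * (∑ z ∈ cube (0 : Site d) (3 * m), 1 / nrm z ^ (p + 1))
          + 4 * 2 ^ p * E₀ * (∑ z ∈ cube (0 : Site d) (3 * m), 1 / nrm z ^ p) / m) +
      Rs * (E₀ * ∑ z ∈ cube (0 : Site d) (3 * m), 1 / nrm z ^ p) +
      B * (d * ((2 * E₁ * 2 ^ (p + 1) * 4 + E₀ * 2 ^ p * 4) / (m : ℝ) ^ (p + 2))) := by
  have hm0 : (0 : ℝ) < m := by exact_mod_cast hm
  set T := cube x (3 * m) with hT
  set χ := cutoff m x with hχ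
  have hB0 : 0 ≤ B := le_trans (Finset.sum_nonneg (fun y _ => abs_nonneg (u y))) hB
  -- support facts for χ
  have h3m : 3 * m - 1 + 1 = 3 * m := by omega
  have hχT : ∀ y, y ∉ T → χ y = 0 := by
    intro y hy
    apply cutoff_eq_zero_of_not_mem hm
    intro h; exact hy (cube_mono (by omega) h)
  have hχT' : ∀ y (e : Site d), supNorm e ≤ 1 → y ∉ T → χ (y - e) = 0 := by
    intro y e he hy
    apply cutoff_eq_zero_of_not_mem hm
    intro h
    apply hy
    have := add_mem_cube_succ h he
    rw [sub_add_cancel, h3m] at this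
    exact this
  have hχsupp : ∀ y, χ y ≠ 0 → y ∈ cube x (3 * m - 1) := by
    intro y hy; by_contra h; exact hy (cutoff_eq_zero_of_not_mem hm h)
  -- Step 1: product rule
  have step1 : ∑ y ∈ T, Φ (x - y) * latticeLaplacianZd (fun z => χ z * u z) y =
      ∑ y ∈ T, Φ (x - y) * (χ y * latticeLaplacianZd u y) +
      ∑ y ∈ T, Φ (x - y) * ∑ i : Fin d, ((χ (y + Pi.single i 1) - χ y) * u (y + Pi.single i 1) +
        (χ (y - Pi.single i 1) - χ y) * u (y - Pi.single i 1)) := by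
    rw [← Finset.sum_add_distrib]
    apply Finset.sum_congr rfl
    intro y _
    rw [lap_mul, mul_add]
  -- Step 2: the shifted form of the second sum (pv23 verbatim)
  set b : Fin d → Site d → ℝ := fun i y =>
    Φ (x - (y - Pi.single i 1)) * (χ y - χ (y - Pi.single i 1)) +
    Φ (x - (y + Pi.single i 1)) * (χ y - χ (y + Pi.single i 1)) with hb
  have step2 : ∑ y ∈ T, Φ (x - y) * ∑ i : Fin d, ((χ (y + Pi.single i 1) - χ y) * u (y + Pi.single i 1) +
        (χ (y - Pi.single i 1) - χ y) * u (y - Pi.single i 1)) =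
      ∑ y ∈ T, u y * ∑ i : Fin d, b i y := by
    simp only [Finset.mul_sum]
    rw [Finset.sum_comm]
    conv_rhs => rw [Finset.sum_comm]
    apply Finset.sum_congr rfl
    intro i _
    have hp : ∑ y ∈ T, Φ (x - y) * (χ (y + Pi.single i 1) - χ y) * u (y + Pi.single i 1) =
        ∑ y ∈ T, Φ (x - (y - Pi.single i 1)) * (χ y - χ (y - Pi.single i 1)) * u y := by
      have := sum_shift T (Pi.single i 1)
        (fun y => Φ (x - (y - Pi.single i 1)) * (χ y - χ (y - Pi.single i 1)) * u y) ?_ ?_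
      · simpa using this
      · intro y hy
        simp [hχT y hy, hχT' y _ (supNorm_single_one i) hy]
      · intro y hy
        have hne : χ y - χ (y - Pi.single i 1) ≠ 0 := by
          intro h; apply hy; simp only [h, mul_zero, zero_mul]
        by_cases h1 : χ y ≠ 0
        · have := sub_mem_cube_succ (hχsupp y h1) (supNorm_single_one i)
          rwa [h3m] at this
        · rw [not_ne_iff] at h1
          rw [h1, zero_sub, neg_ne_zero] at hne
          exact cube_mono (by omega) (hχsupp _ hne)
    have hq' : ∑ y ∈ T, Φ (x - y) * (χ (y - Pi.single i 1) - χ y) * u (y - Pi.single i 1) =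
        ∑ y ∈ T, Φ (x - (y + Pi.single i 1)) * (χ y - χ (y + Pi.single i 1)) * u y := by
      have := sum_shift T (Pi.single i 1)
        (fun y => Φ (x - y) * (χ (y - Pi.single i 1) - χ y) * u (y - Pi.single i 1)) ?_ ?_
      · simpa using this.symm
      · intro y hy
        simp [hχT y hy, hχT' y _ (supNorm_single_one i) hy]
      · intro y hy
        have hne : χ (y - Pi.single i 1) - χ y ≠ 0 := by
          intro h; apply hy; simp only [h, mul_zero, zero_mul]
        by_cases h1 : χ (y - Pi.single i 1) ≠ 0
        · exact cube_mono (by omega) (hχsupp _ h1)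
        · rw [not_ne_iff] at h1
          rw [h1, zero_sub, neg_ne_zero] at hne
          have := sub_mem_cube_succ (hχsupp y hne) (supNorm_single_one i)
          rwa [h3m] at this
    have hsplit : ∑ y ∈ T, Φ (x - y) * ((χ (y + Pi.single i 1) - χ y) * u (y + Pi.single i 1) +
          (χ (y - Pi.single i 1) - χ y) * u (y - Pi.single i 1)) =
        ∑ y ∈ T, Φ (x - y) * (χ (y + Pi.single i 1) - χ y) * u (y + Pi.single i 1) +
        ∑ y ∈ T, Φ (x - y) * (χ (y - Pi.single i 1) - χ y) * u (y - Pi.single i 1) := by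
      rw [← Finset.sum_add_distrib]
      apply Finset.sum_congr rfl; intro y _; ring
    rw [hsplit, hp, hq', ← Finset.sum_add_distrib]
    apply Finset.sum_congr rfl
    intro y _
    simp only [hb]
    ring
  -- Step 3: pointwise bound on the brackets (pv23 verbatim)
  have hbb : ∀ y (i : Fin d), |b i y| ≤ (2 * E₁ * 2 ^ (p + 1) * 4 + E₀ * 2 ^ p * 4) / (m : ℝ) ^ (p + 2) := by
    intro y i
    have hrhs : 0 ≤ (2 * E₁ * 2 ^ (p + 1) * 4 + E₀ * 2 ^ p * 4) / (m : ℝ) ^ (p + 2) := by positivity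
    by_cases hnear : ∀ j, |y j - x j| + 1 ≤ m
    · obtain ⟨h0, h1, h2⟩ := cutoff_shift_eq_one hnear i
      have : b i y = 0 := by
        simp only [hb]
        rw [show χ y = 1 from h0, show χ (y + Pi.single i 1) = 1 from h1,
          show χ (y - Pi.single i 1) = 1 from h2]
        ring
      rw [this, abs_zero]; exact hrhs
    · simp only [not_forall, not_le] at hnear
      obtain ⟨j, hj⟩ := hnear
      set z := x - y with hz
      have hmz : m ≤ supNorm z := by
        apply le_supNorm_of (i := j)
        rw [hz, Pi.sub_apply, abs_sub_comm]
        omega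
      have e1 : x - (y - Pi.single i 1) = z + Pi.single i 1 := by rw [hz]; abel
      have e2 : x - (y + Pi.single i 1) = z - Pi.single i 1 := by rw [hz]; abel
      have key : b i y = (Φ (z + Pi.single i 1) - Φ (z - Pi.single i 1)) * (χ y - χ (y - Pi.single i 1))
          - Φ (z - Pi.single i 1) * (χ (y + Pi.single i 1) - 2 * χ y + χ (y - Pi.single i 1)) := by
        simp only [hb]; rw [e1, e2]; ring
      have hn1 : (m : ℝ) / 2 ≤ nrm z := half_le_nrm hmz
      have hn2 : (m : ℝ) / 2 ≤ nrm (z - Pi.single i 1) := by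
        rw [sub_eq_add_neg]
        exact half_le_nrm_add hmz (by rw [supNorm_neg]; exact supNorm_single_one i)
      have hΦ1 : |Φ (z + Pi.single i 1) - Φ (z - Pi.single i 1)| ≤ 2 * E₁ * 2 ^ (p + 1) / (m : ℝ) ^ (p + 1) := by
        have ha := (hΦd z i).1
        have hb' := (hΦd z i).2
        have hc : 1 / nrm z ^ (p + 1) ≤ 2 ^ (p + 1) / (m : ℝ) ^ (p + 1) := inv_nrm_pow_le hm hn1
        calc |Φ (z + Pi.single i 1) - Φ (z - Pi.single i 1)|
            ≤ |Φ (z + Pi.single i 1) - Φ z| + |Φ (z - Pi.single i 1) - Φ z| := by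
              rw [abs_sub_comm (Φ (z - Pi.single i 1))]; exact abs_sub_le _ _ _
          _ ≤ E₁ / nrm z ^ (p + 1) + E₁ / nrm z ^ (p + 1) := add_le_add ha hb'
          _ = 2 * E₁ * (1 / nrm z ^ (p + 1)) := by ring
          _ ≤ 2 * E₁ * (2 ^ (p + 1) / (m : ℝ) ^ (p + 1)) := mul_le_mul_of_nonneg_left hc (by positivity)
          _ = _ := by ring
      have hΦ2 : |Φ (z - Pi.single i 1)| ≤ E₀ * 2 ^ p / (m : ℝ) ^ p := by
        have ha := hΦ (z - Pi.single i 1)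
        have hc : 1 / nrm (z - Pi.single i 1) ^ p ≤ 2 ^ p / (m : ℝ) ^ p := inv_nrm_pow_le hm hn2
        calc _ ≤ E₀ / nrm (z - Pi.single i 1) ^ p := ha
          _ = E₀ * (1 / nrm (z - Pi.single i 1) ^ p) := by ring
          _ ≤ E₀ * (2 ^ p / (m : ℝ) ^ p) := mul_le_mul_of_nonneg_left hc hE₀
          _ = _ := by ring
      have hχ1 : |χ y - χ (y - Pi.single i 1)| ≤ 4 / m := by
        rw [abs_sub_comm]; exact (cutoff_diff_le hm x y i).2
      have hχ2 : |χ (y + Pi.single i 1) - 2 * χ y + χ (y - Pi.single i 1)| ≤ 4 / (m : ℝ) ^ 2 :=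
        cutoff_diff2_le hm x y i
      rw [key]
      calc _ ≤ |(Φ (z + Pi.single i 1) - Φ (z - Pi.single i 1)) * (χ y - χ (y - Pi.single i 1))|
            + |Φ (z - Pi.single i 1) * (χ (y + Pi.single i 1) - 2 * χ y + χ (y - Pi.single i 1))| :=
            abs_sub _ _
        _ ≤ (2 * E₁ * 2 ^ (p + 1) / (m : ℝ) ^ (p + 1)) * (4 / m) + (E₀ * 2 ^ p / (m : ℝ) ^ p) * (4 / (m : ℝ) ^ 2) := by
            rw [abs_mul, abs_mul]
            exact add_le_add (mul_le_mul hΦ1 hχ1 (abs_nonneg _) (by positivity))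
              (mul_le_mul hΦ2 hχ2 (abs_nonneg _) (by positivity))
        _ = _ := by
            field_simp
            ring
  -- Step 4 (NEW): the `χΔu` term with the source in divergence form
  set Sp : ℝ := ∑ z ∈ cube (0 : Site d) (3 * m), 1 / nrm z ^ p with hSp
  set Sp1 : ℝ := ∑ z ∈ cube (0 : Site d) (3 * m), 1 / nrm z ^ (p + 1) with hSp1
  have hSp0 : 0 ≤ Sp := Finset.sum_nonneg fun z _ => by have := nrm_pos z; positivity
  -- the weight of `q(y, μ)` after the summation by parts, and its pointwise bound
  set w : Fin d → Site d → ℝ := fun μ y => Φ (x - y) * χ y - Φ (x - (y + Pi.single μ 1)) * χ (y + Pi.single μ 1) with hw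
  have hwb : ∀ (y : Site d) (μ : Fin d), |w μ y| ≤ E₁ / nrm (x - y) ^ (p + 1) + 4 * 2 ^ p * E₀ / nrm (x - y) ^ p / m := by
    intro y μ
    set v := x - y with hv
    have ev : x - (y + Pi.single μ 1) = v - Pi.single μ 1 := by rw [hv]; abel
    have e1 : w μ y = (Φ v - Φ (v - Pi.single μ 1)) * χ y + Φ (v - Pi.single μ 1) * (χ y - χ (y + Pi.single μ 1)) := by
      simp only [hw]; rw [ev]; ring
    have h1 : |Φ v - Φ (v - Pi.single μ 1)| ≤ E₁ / nrm v ^ (p + 1) := by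
      rw [abs_sub_comm]; exact (hΦd v μ).2
    have h2 : |χ y| ≤ 1 := abs_cutoff_le_one hm x y
    have h3 : |Φ (v - Pi.single μ 1)| ≤ 2 ^ p * E₀ / nrm v ^ p := by
      have ha := hΦ (v - Pi.single μ 1)
      have hhalf : nrm v / 2 ≤ nrm (v - Pi.single μ 1) := by
        rw [sub_eq_add_neg]; exact nrm_shift_ge_half v _ (by rw [supNorm_neg]; exact supNorm_single_one μ)
      have hposv := nrm_pos v
      have hpos := nrm_pos (v - Pi.single μ 1)
      refine ha.trans ?_
      rw [div_le_div_iff₀ (pow_pos hpos p) (pow_pos hposv p)]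
      calc E₀ * nrm v ^ p = E₀ * ((nrm v / 2) ^ p * 2 ^ p) := by rw [div_pow, div_mul_cancel₀ _ (by positivity)]
        _ ≤ E₀ * (nrm (v - Pi.single μ 1) ^ p * 2 ^ p) := by
            apply mul_le_mul_of_nonneg_left _ hE₀
            exact mul_le_mul_of_nonneg_right (pow_le_pow_left₀ (by positivity) hhalf p) (by positivity)
        _ = 2 ^ p * E₀ * nrm (v - Pi.single μ 1) ^ p := by ring
    have h4 : |χ y - χ (y + Pi.single μ 1)| ≤ 4 / m := by
      rw [abs_sub_comm]; exact (cutoff_diff_le hm x y μ).1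
    have hE1' : 0 ≤ E₁ / nrm v ^ (p + 1) := by have := nrm_pos v; positivity
    have hE0' : 0 ≤ 2 ^ p * E₀ / nrm v ^ p := by have := nrm_pos v; positivity
    rw [e1]
    calc |(Φ v - Φ (v - Pi.single μ 1)) * χ y + Φ (v - Pi.single μ 1) * (χ y - χ (y + Pi.single μ 1))|
        ≤ |(Φ v - Φ (v - Pi.single μ 1)) * χ y| + |Φ (v - Pi.single μ 1) * (χ y - χ (y + Pi.single μ 1))| := abs_add_le _ _
      _ ≤ E₁ / nrm v ^ (p + 1) * 1 + 2 ^ p * E₀ / nrm v ^ p * (4 / m) := by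
          rw [abs_mul, abs_mul]
          exact add_le_add (mul_le_mul h1 h2 (abs_nonneg _) hE1') (mul_le_mul h3 h4 (abs_nonneg _) hE0')
      _ = _ := by ring
  -- summation by parts for each direction
  have hsbp : ∀ μ : Fin d, ∑ y ∈ T, Φ (x - y) * (χ y * (q y μ - q (y - Pi.single μ 1) μ)) = ∑ y ∈ T, w μ y * q y μ := by
    intro μ
    have hsh := sum_shift T (Pi.single μ 1) (fun y => Φ (x - y) * χ y * q (y - Pi.single μ 1) μ) ?_ ?_
    rotate_left
    · intro y hy
      simp [hχT y hy]
    · intro y hy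
      have hne : χ y ≠ 0 := by
        intro h; apply hy; simp only [h, mul_zero, zero_mul]
      have := sub_mem_cube_succ (hχsupp y hne) (supNorm_single_one μ)
      rwa [h3m] at this
    -- `hsh : Σ_T Φ(x−(y+e))χ(y+e)q(y,μ) = Σ_T Φ(x−y)χ(y)q(y−e,μ)`
    have hsh' : ∑ y ∈ T, Φ (x - (y + Pi.single μ 1)) * χ (y + Pi.single μ 1) * q y μ
        = ∑ y ∈ T, Φ (x - y) * χ y * q (y - Pi.single μ 1) μ := by
      simpa using hsh
    calc ∑ y ∈ T, Φ (x - y) * (χ y * (q y μ - q (y - Pi.single μ 1) μ))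
        = ∑ y ∈ T, Φ (x - y) * χ y * q y μ - ∑ y ∈ T, Φ (x - y) * χ y * q (y - Pi.single μ 1) μ := by
          rw [← Finset.sum_sub_distrib]; exact Finset.sum_congr rfl fun y _ => by ring
      _ = ∑ y ∈ T, Φ (x - y) * χ y * q y μ - ∑ y ∈ T, Φ (x - (y + Pi.single μ 1)) * χ (y + Pi.single μ 1) * q y μ := by rw [hsh']
      _ = ∑ y ∈ T, w μ y * q y μ := by
          rw [← Finset.sum_sub_distrib]; exact Finset.sum_congr rfl fun y _ => by simp only [hw]; ring
  have hS1 : |∑ y ∈ T, Φ (x - y) * (χ y * latticeLaplacianZd u y)| ≤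
      d * Qs * (E₁ * Sp1 + 4 * 2 ^ p * E₀ * Sp / m) + Rs * (E₀ * Sp) := by
    -- split the source
    have hsrc : ∑ y ∈ T, Φ (x - y) * (χ y * latticeLaplacianZd u y)
        = ∑ μ : Fin d, ∑ y ∈ T, w μ y * q y μ + ∑ y ∈ T, Φ (x - y) * (χ y * r y) := by
      have e1 : ∑ y ∈ T, Φ (x - y) * (χ y * latticeLaplacianZd u y)
          = ∑ y ∈ T, (∑ μ : Fin d, Φ (x - y) * (χ y * (q y μ - q (y - Pi.single μ 1) μ)) + Φ (x - y) * (χ y * r y)) := by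
        refine Finset.sum_congr rfl fun y hy => ?_
        rw [hdiv y hy, mul_add, mul_add, Finset.mul_sum, Finset.mul_sum]
      rw [e1, Finset.sum_add_distrib, Finset.sum_comm]
      congr 1
      exact Finset.sum_congr rfl fun μ _ => hsbp μ
    -- the `q` part
    have hqpart : ∀ μ : Fin d, |∑ y ∈ T, w μ y * q y μ| ≤ Qs * (E₁ * Sp1 + 4 * 2 ^ p * E₀ * Sp / m) := by
      intro μ
      calc |∑ y ∈ T, w μ y * q y μ| ≤ ∑ y ∈ T, |w μ y * q y μ| := Finset.abs_sum_le_sum_abs _ _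
        _ ≤ ∑ y ∈ T, (E₁ / nrm (x - y) ^ (p + 1) + 4 * 2 ^ p * E₀ / nrm (x - y) ^ p / m) * Qs := by
            refine Finset.sum_le_sum fun y hy => ?_
            rw [abs_mul]
            have h0 : 0 ≤ E₁ / nrm (x - y) ^ (p + 1) + 4 * 2 ^ p * E₀ / nrm (x - y) ^ p / m := by
              have := nrm_pos (x - y); positivity
            exact mul_le_mul (hwb y μ) (hq y hy μ) (abs_nonneg _) h0
        _ = Qs * (E₁ * ∑ y ∈ T, 1 / nrm (x - y) ^ (p + 1) + 4 * 2 ^ p * E₀ * (∑ y ∈ T, 1 / nrm (x - y) ^ p) / m) := by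
            have hAsum : ∑ y ∈ T, E₁ / nrm (x - y) ^ (p + 1) = E₁ * ∑ y ∈ T, 1 / nrm (x - y) ^ (p + 1) := by
              rw [Finset.mul_sum]; exact Finset.sum_congr rfl fun _ _ => by ring
            have hBsum : ∑ y ∈ T, 4 * 2 ^ p * E₀ / nrm (x - y) ^ p / m = 4 * 2 ^ p * E₀ * (∑ y ∈ T, 1 / nrm (x - y) ^ p) / m := by
              rw [Finset.mul_sum, Finset.sum_div]; exact Finset.sum_congr rfl fun _ _ => by ring
            rw [← Finset.sum_mul, Finset.sum_add_distrib, hAsum, hBsum]; ring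
        _ = Qs * (E₁ * Sp1 + 4 * 2 ^ p * E₀ * Sp / m) := by
            rw [hSp, hSp1, hT, sum_cube_reflect x (3 * m) (fun z => 1 / nrm z ^ (p + 1)), sum_cube_reflect x (3 * m) (fun z => 1 / nrm z ^ p)]
    -- the `r` part
    have hrpart : |∑ y ∈ T, Φ (x - y) * (χ y * r y)| ≤ Rs * (E₀ * Sp) := by
      calc _ ≤ ∑ y ∈ T, |Φ (x - y) * (χ y * r y)| := Finset.abs_sum_le_sum_abs _ _
        _ ≤ ∑ y ∈ T, E₀ / nrm (x - y) ^ p * Rs := by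
            refine Finset.sum_le_sum fun y hy => ?_
            rw [abs_mul, abs_mul]
            have h4 : 0 ≤ E₀ / nrm (x - y) ^ p := by have := nrm_pos (x - y); positivity
            calc |Φ (x - y)| * (|χ y| * |r y|) ≤ (E₀ / nrm (x - y) ^ p) * (1 * Rs) :=
                  mul_le_mul (hΦ (x - y)) (mul_le_mul (abs_cutoff_le_one hm x y) (hr y hy) (abs_nonneg _) zero_le_one) (by positivity) h4
              _ = _ := by ring
        _ = Rs * (E₀ * ∑ y ∈ T, 1 / nrm (x - y) ^ p) := by
            rw [Finset.mul_sum, Finset.mul_sum]; exact Finset.sum_congr rfl fun y _ => by ring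
        _ = Rs * (E₀ * Sp) := by rw [hSp, hT, sum_cube_reflect x (3 * m) (fun z => 1 / nrm z ^ p)]
    rw [hsrc]
    calc |∑ μ : Fin d, ∑ y ∈ T, w μ y * q y μ + ∑ y ∈ T, Φ (x - y) * (χ y * r y)|
        ≤ |∑ μ : Fin d, ∑ y ∈ T, w μ y * q y μ| + |∑ y ∈ T, Φ (x - y) * (χ y * r y)| := abs_add_le _ _
      _ ≤ ∑ μ : Fin d, |∑ y ∈ T, w μ y * q y μ| + Rs * (E₀ * Sp) := add_le_add (Finset.abs_sum_le_sum_abs _ _) hrpart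
      _ ≤ ∑ _μ : Fin d, Qs * (E₁ * Sp1 + 4 * 2 ^ p * E₀ * Sp / m) + Rs * (E₀ * Sp) :=
          add_le_add (Finset.sum_le_sum fun μ _ => hqpart μ) le_rfl
      _ = d * Qs * (E₁ * Sp1 + 4 * 2 ^ p * E₀ * Sp / m) + Rs * (E₀ * Sp) := by
          rw [Finset.sum_const, Finset.card_univ, Fintype.card_fin, nsmul_eq_mul]; ring
  -- Step 5: the cutoff part (pv23 verbatim) and assembly
  have hS2 : |∑ y ∈ T, u y * ∑ i : Fin d, b i y| ≤
      B * (d * ((2 * E₁ * 2 ^ (p + 1) * 4 + E₀ * 2 ^ p * 4) / (m : ℝ) ^ (p + 2))) := by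
    set Kb := (2 * E₁ * 2 ^ (p + 1) * 4 + E₀ * 2 ^ p * 4) / (m : ℝ) ^ (p + 2) with hKb
    have hKb0 : 0 ≤ Kb := by positivity
    calc _ ≤ ∑ y ∈ T, |u y * ∑ i : Fin d, b i y| := Finset.abs_sum_le_sum_abs _ _
      _ ≤ ∑ y ∈ T, |u y| * (d * Kb) := by
          apply Finset.sum_le_sum
          intro y _
          rw [abs_mul]
          apply mul_le_mul_of_nonneg_left _ (abs_nonneg _)
          calc |∑ i : Fin d, b i y| ≤ ∑ i : Fin d, |b i y| := Finset.abs_sum_le_sum_abs _ _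
            _ ≤ ∑ _i : Fin d, Kb := Finset.sum_le_sum (fun i _ => hbb y i)
            _ = d * Kb := by simp
      _ = (∑ y ∈ T, |u y|) * (d * Kb) := by rw [Finset.sum_mul]
      _ ≤ B * (d * Kb) := mul_le_mul_of_nonneg_right hB (by positivity)
  rw [step1, step2]
  calc _ ≤ |∑ y ∈ T, Φ (x - y) * (χ y * latticeLaplacianZd u y)| + |∑ y ∈ T, u y * ∑ i : Fin d, b i y| :=
        abs_add_le _ _
    _ ≤ _ := add_le_add hS1 hS2

end

end Summit.QuantumFields.BalabanUV.T4Continuum.NE7FlatInteriorCoreDivForm
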